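import Literature.NumberTheory.ConnesConsani2021.ProlateTraceIdentities
import Literature.NumberTheory.ConnesConsani2021.ProlateProjectionsCompleteness
import HarnessLib

/-!
# Connes–Consani 2021, Remark 4.6 (ii) — the symmetric form of (chirem1) for all `ρ > 0`, discharged

LINE 1 — FRAMING: RH-FREE corpus literature (Connes–Consani, *Spectral triples and ζ-cycles*,
arXiv:2006.13771, §4 Remark 4.6 (ii) p. 18: matrix coefficients of the scaling action against the prolate
vectors); cell rh-crit, sub-cell cc, corpus C1, row t3 (statement layer `ProlateProjections`); bears_on:
W-C/W-P only as §4 FACT-LIST bookkeeping (off the K1 path).  WHAT THIS IS NOT: any claim about RH —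
nothing in this file bears on the truth of RH.

The named fact `CC2021_rem_4_6_ii_sym` of the statement layer is PROVED (`CC2021_rem_4_6_ii_sym_holds`),
exactly as printed: from (chirem1) for `ρ ≥ 1` (`CC2021_prop_4_5_ii`, a theorem through
`CC2021_prop_4_5_ii_of_xi_complete` (seat t2, `ProlateTraceIdentities`) and the completeness theorem
`CC2021_sec4_xi_complete_holds` (`ProlateProjectionsCompleteness`, via `ProlateCommutation` /
`ProlateSincOperator`)), (sym1) (`CC2021_rem_4_6_ii_holds`), the adjunction of the scaling action
`⟨u|ϑ(ρ)v⟩ = conj⟨v|ϑ(ρ⁻¹)u⟩` (`repCoeff_inv_eq_conj`, substitution `x = ρy`), reality of the prolate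
vectors, and `δ(ρ⁻¹) = δ(ρ)` (`traceRemainder_inv`).  (Remark 4.6 (i)'s pointwise identity is seat t12's
`ProlatePointwiseParseval`.)  No definitions, no new facts (D-0026).

## References
* [ConnesConsani2021] §4 Remark 4.6 (ii) p. 18 (arXiv item Remark 26, p0018:L17–L29); Prop. 4.5 (ii)
  eq. (chirem1) p. 16; eq. (40) p. 15.
-/

noncomputable section

open _root_.MeasureTheory Complex Set Filter Topology
open scoped Real ComplexConjugate ENNReal InnerProductSpace

namespace Literature.NumberTheory.ConnesConsani2021

open Literature.NumberTheory.LFunctions Literature.Analysis.OperatorTheory Submodule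

/-! ## Remark 4.6 (ii): the symmetric form of (chirem1) for all `ρ > 0` -/

section Sym

/-- Complex conjugate of a matrix coefficient: `conj⟨u|ϑ(ρ⁻¹)v⟩ = ⟨ū|ϑ(ρ⁻¹)v̄⟩` (`ρ > 0`).
[cite: ConnesConsani2021, §4 eq. (40) p. 15 (arXiv p0015:L38–L41)] -/
theorem conj_repCoeff (u v : ℝ → ℂ) {ρ : ℝ} (hρ : 0 < ρ) :
    conj (repCoeff u v ρ) = repCoeff (fun x ↦ conj (u x)) (fun x ↦ conj (v x)) ρ := by
  rw [repCoeff_eq hρ, repCoeff_eq hρ, ← integral_conj]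
  refine integral_congr_ae (ae_of_all _ fun x ↦ ?_)
  simp only [map_mul, Complex.conj_conj, Complex.conj_ofReal]

/-- **Adjunction of the scaling action**: `⟨u|ϑ(ρ)v⟩ = conj⟨v|ϑ(ρ⁻¹)u⟩`, i.e.
`repCoeff u v ρ⁻¹ = conj (repCoeff v u ρ)` for `ρ > 0` (`ϑ(ρ)` is unitary with `ϑ(ρ)* = ϑ(ρ⁻¹)`; here by
the substitution `x = ρy`). [cite: ConnesConsani2021, §4 eq. (40) p. 15 (arXiv p0015:L38–L41); Remark 4.6 (ii) p. 18 (arXiv p0018:L25–L29)] -/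
theorem repCoeff_inv_eq_conj (u v : ℝ → ℂ) {ρ : ℝ} (hρ : 0 < ρ) :
    repCoeff u v ρ⁻¹ = conj (repCoeff v u ρ) := by
  have hρ' : 0 < ρ⁻¹ := inv_pos.2 hρ
  rw [repCoeff_eq hρ', repCoeff_eq hρ, ← integral_conj]
  set F : ℝ → ℂ := fun x ↦ conj (u x) * (((Real.sqrt ρ⁻¹ : ℝ) : ℂ) * v (ρ⁻¹ * x)) with hF
  have h := Measure.integral_comp_mul_left F ρ
  have hsub : ∫ x, F x = ∫ y, (|ρ| : ℝ) • F (ρ * y) := by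
    rw [integral_smul, h, smul_smul, abs_inv, mul_inv_cancel₀ (abs_pos.2 hρ.ne').ne', one_smul]
  have hsR : ρ * Real.sqrt ρ⁻¹ = Real.sqrt ρ := by
    rw [Real.sqrt_inv, ← div_eq_mul_inv, div_eq_iff (Real.sqrt_pos.2 hρ).ne', Real.mul_self_sqrt hρ.le]
  have hs : (ρ : ℂ) * ((Real.sqrt ρ⁻¹ : ℝ) : ℂ) = ((Real.sqrt ρ : ℝ) : ℂ) := by
    rw [← Complex.ofReal_mul, hsR]
  change ∫ x, F x = _
  rw [hsub]
  refine integral_congr_ae (ae_of_all _ fun y ↦ ?_)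
  simp only [hF, map_mul, Complex.conj_conj, Complex.conj_ofReal, abs_of_pos hρ, Complex.real_smul]
  rw [← mul_assoc ρ⁻¹ ρ y, inv_mul_cancel₀ hρ.ne', one_mul]
  linear_combination conj (u (ρ * y)) * v y * hs

/-- The coefficients of the real-valued prolate vectors are conjugation-invariant:
`conj⟨ξ_n|ϑ(ρ⁻¹)ξ_n⟩ = ⟨ξ_n|ϑ(ρ⁻¹)ξ_n⟩`. [cite: ConnesConsani2021, Remark 4.6 (ii) §4 p. 18 (arXiv p0018:L25–L29)] -/
theorem conj_repCoeff_prolateXiFun_prolateXiFun (n : ℕ) {ρ : ℝ} (hρ : 0 < ρ) :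
    conj (repCoeff (prolateXiFun n) (prolateXiFun n) ρ) = repCoeff (prolateXiFun n) (prolateXiFun n) ρ := by
  rw [conj_repCoeff _ _ hρ]
  simp only [prolateXiFun, Complex.conj_ofReal]
  rfl

/-- `conj⟨ψ_n|ϑ(ρ⁻¹)ξ_n⟩ = ⟨ψ_n|ϑ(ρ⁻¹)ξ_n⟩`. [cite: ConnesConsani2021, Remark 4.6 (ii) §4 p. 18 (arXiv p0018:L25–L29)] -/
theorem conj_repCoeff_prolatePsiFun_prolateXiFun (n : ℕ) {ρ : ℝ} (hρ : 0 < ρ) :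
    conj (repCoeff (prolatePsiFun n) (prolateXiFun n) ρ) = repCoeff (prolatePsiFun n) (prolateXiFun n) ρ := by
  rw [conj_repCoeff _ _ hρ]
  simp only [prolateXiFun, Complex.conj_ofReal, conj_prolatePsiFun]
  rfl

/-- For `ρ ≥ 1`: `⟨ξ_n|ϑ(ρ)ψ_n⟩ = 0` ((sym1) transported by the adjunction). [cite: ConnesConsani2021, Remark 4.6 (ii) §4 p. 18 eq. (sym1) (arXiv p0018:L17–L29)] -/
theorem repCoeff_prolateXiFun_prolatePsiFun_inv_eq_zero (n : ℕ) {ρ : ℝ} (hρ : 1 ≤ ρ) :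
    repCoeff (prolateXiFun n) (prolatePsiFun n) ρ⁻¹ = 0 := by
  have hρ0 : 0 < ρ := lt_of_lt_of_le one_pos hρ
  rw [repCoeff_inv_eq_conj _ _ hρ0, (CC2021_rem_4_6_ii_holds n ρ hρ).1, map_zero]

/-- For `0 < ρ ≤ 1`: `⟨ξ_n|ϑ(ρ⁻¹)ψ_n⟩ = 0`. [cite: ConnesConsani2021, Remark 4.6 (ii) §4 p. 18 eq. (sym1) (arXiv p0018:L17–L29)] -/
theorem repCoeff_prolateXiFun_prolatePsiFun_eq_zero_of_le_one (n : ℕ) {ρ : ℝ} (hρ0 : 0 < ρ) (hρ : ρ ≤ 1) :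
    repCoeff (prolateXiFun n) (prolatePsiFun n) ρ = 0 := by
  have h := repCoeff_prolateXiFun_prolatePsiFun_inv_eq_zero n (one_le_inv_iff₀.2 ⟨hρ0, hρ⟩)
  rwa [inv_inv] at h

/-- **Remark 4.6 (ii) from (chirem1)**: the symmetric form of (chirem1) holds for all `ρ > 0`.
For `ρ ≥ 1` the extra term `⟨ξ_n|ϑ(ρ)ψ_n⟩` vanishes by (sym1); for `ρ < 1` apply (chirem1) at `ρ⁻¹`,
use `δ(ρ⁻¹) = δ(ρ)`, `⟨ξ_n|ϑ(ρ)ξ_n⟩ = ⟨ξ_n|ϑ(ρ⁻¹)ξ_n⟩` (adjunction + reality) and `⟨ξ_n|ϑ(ρ⁻¹)ψ_n⟩ = 0`.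
[cite: ConnesConsani2021, Remark 4.6 (ii) §4 p. 18 (arXiv item Remark 26, p0018:L17–L29)] -/
theorem CC2021_rem_4_6_ii_sym_of_prop_4_5_ii (h : CC2021_prop_4_5_ii) : CC2021_rem_4_6_ii_sym := by
  intro ρ hρ
  rcases le_or_gt 1 ρ with h1 | h1
  · have hs := h ρ h1
    refine hs.congr_fun fun n ↦ ?_
    rw [repCoeff_prolateXiFun_prolatePsiFun_inv_eq_zero n h1, add_zero]
  · have hρ' : 1 ≤ ρ⁻¹ := (one_le_inv_iff₀.2 ⟨hρ, h1.le⟩)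
    have hs := h ρ⁻¹ hρ'
    rw [traceRemainder_inv] at hs
    refine hs.congr_fun fun n ↦ ?_
    rw [repCoeff_prolateXiFun_prolatePsiFun_eq_zero_of_le_one n hρ h1.le, zero_add,
      repCoeff_inv_eq_conj (prolateXiFun n) (prolatePsiFun n) hρ,
      repCoeff_inv_eq_conj (prolateXiFun n) (prolateXiFun n) hρ, conj_repCoeff_prolateXiFun_prolateXiFun n hρ]

/-- **Remark 4.6 (ii) from completeness** (through `CC2021_prop_4_5_ii_of_xi_complete`).
[cite: ConnesConsani2021, Remark 4.6 (ii) §4 p. 18 (arXiv item Remark 26, p0018:L17–L29)] -/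
theorem CC2021_rem_4_6_ii_sym_of_xi_complete (h : CC2021_sec4_xi_complete) : CC2021_rem_4_6_ii_sym :=
  CC2021_rem_4_6_ii_sym_of_prop_4_5_ii (CC2021_prop_4_5_ii_of_xi_complete h)

/-- **Remark 4.6 (ii) (symmetric (chirem1) for all `ρ > 0`) — DISCHARGED** (completeness is the theorem
`CC2021_sec4_xi_complete_holds`). [cite: ConnesConsani2021, Remark 4.6 (ii) §4 p. 18 (arXiv item Remark 26, p0018:L17–L29)] -/
theorem CC2021_rem_4_6_ii_sym_holds : CC2021_rem_4_6_ii_sym :=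
  CC2021_rem_4_6_ii_sym_of_xi_complete CC2021_sec4_xi_complete_holds

end Sym


end Literature.NumberTheory.ConnesConsani2021
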